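import Summits.BirchSwinnertonDyer.BirchSwinnertonDyer.Theorems.AlignedTransportAtTwoOffStratumPartitionTwistFamilyZhaiTransport
import Summits.BirchSwinnertonDyer.BirchSwinnertonDyer.Theorems.TwoAdicConverseFrobeniusParityTwoDivisionRoot
import HarnessLib

/-!
# Route `AlignedTransportAtTwo`, crux C2 `MainConjectureOfRankZeroBSDAtTwo` (stmt-22298), line `birth` — THE `a_q`-ODD TWIST CLASS OF `1727a1`:
# MEMBERSHIP BY ONE `decide`, and thirteen explicit prime-star members `1727a1^{(q*)}` up to conductor `1727·107² = 19 772 423`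

HONEST FRAMING (cell `bsd-f1-sign2`, WIDTH-5 attach seat `bsd-line-att-p4` g24; `--supports stmt-BirchSwinnertonDyer-22298 --as helper`).
THEOREMS ONLY (no `def`, no named fact, no `sorry`). BSD is NOT proved; nothing is asserted — every row is CONDITIONAL on the displayed PRINT
named facts and the two displayed data of `1727a1`. Sequel of `…TwistFamilyZhaiTransport` (generic print-transport + row `1727a1`) and
`…TwistFamilyZhaiTransportExplicit` (members via certified point counts), same seat, same gen.

WHY. Membership in the `a_q`-odd class needs `Odd (a_q(1727a1))` for the primes `q ∣ d`. Rather than a point count, the tree's parity dictionary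
`TwoAdicTwistConverse.odd_frobeniusTrace_iff_forall_ne_zero` (`a_q` odd ⟺ the reduced `2`-division cubic `4x³ − 3x² − 304x + 1100` of Cremona's
model `[1, −1, 0, −76, 275]` has NO root mod `q`) makes it ONE `decide` over `ZMod q`:
* §1 `integralModelInt_b_1727a1` (`b₂, b₄, b₆ = −3, −152, 1100`), **`odd_frobeniusTrace_1727a1_of_forall_ne_zero`** (`q` odd, `q ∤ 1727`, no root
  mod `q` ⟹ `a_q` odd); §1b the no-root certificates `forall_ne_zero_1727a1_q` for `q ∈ {3, 29, 31, 37, 41, 43, 47, 67, 71, 73, 79, 83, 107}`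
  (`decide +kernel`).
* §2 **`bsdp_two_twist_1727a1_primeStar_of_forall_ne_zero`** — for an odd prime `q ∤ 1727` with no root mod `q` and `d ∈ {q, −q}`, `d ≡ 1 (mod 4)`:
  every globally minimal model `W` of `1727a1^{(d)}` has `r_an(W) = 0 ∧ rank 0 ∧ Ш(W)[2^∞] = 0 ∧ c(W)` odd `∧ BSD(W, 2)`, modulo PRINT⁷
  {Zhai 1.1′/1.2′, Mazur–Rubin L. 2.10, modularity, Abbes–Ullmo, Creutz–Miller, GZK} + displayed {`Dt`, `hL`}.
* §3 MEMBERS by `decide`: `d = −31, 37, 41, −43, −47, −67, −71, 73, −79, −83, −107` (primes with `a_q(1727a1)` odd; `37` is also in Zhai's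
  arXiv-v2 split family, g23) and the composites `d = −87 = (−3)·29`, `d = 93 = 3·31` — conductors `1727·d²` from `1 659 647` to `19 772 423`, beyond
  the range of the printed / LMFDB tables, `BSD(W, 2)` by print-transport with NO certificate.

PARTITION CURRENCY (D-0171): unchanged (these are members of the `T_Z` cell settled by the parent file); the point is the MEMBERSHIP TEST is a
kernel `decide`, so -data's LMFDB `a_q` tags and the kernel agree by construction (and, with `…ZhaiInertIffOddTrace`, with Zhai's «inert» form).
Beyond-print theorem: no. BSD is NOT proved.

References: [Zhai2016] Thm. 1.1; [MazurRubin2010] Lemma 2.10; [AbbesUllmo1996] Thm. A; [CreutzMiller2012] Thm. 1.1; [Miller2011LMS] Def. 1.1;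
[CremonaAlgorithms1997] Table 1 (`1727a1`); [SilvermanAEC2009] III.2.3, V.2.
-/

set_option autoImplicit false
set_option linter.dupNamespace false

noncomputable section

open scoped Classical

open WeierstrassCurve NumberField
open Literature.NumberTheory.EllipticCurves Literature.NumberTheory.EllipticCurves.ModularForms
open Literature.NumberTheory.EllipticCurves.Rank1Residual Literature.NumberTheory.EllipticCurves.Rank1Residual.Typed
open Literature.NumberTheory.EllipticCurves.CoatesLiTianZhai2015 Literature.NumberTheory.EllipticCurves.Zhai2016
open Summit.BirchSwinnertonDyer.Rank1Residual Summit.BirchSwinnertonDyer.Rank1Residual.X5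
open Summit.BirchSwinnertonDyer.Uniform
open Summit.BirchSwinnertonDyer.BirchSwinnertonDyer.Theorems.TowerClass
open Summit.BirchSwinnertonDyer.BirchSwinnertonDyer.Theorems.AlignedTransportAtTwoTwistFamilySmallSeeds
open Summit.BirchSwinnertonDyer.BirchSwinnertonDyer.Theorems.AlignedTransportAtTwoTwistFamilyZhaiTransport
open Summit.BirchSwinnertonDyer.BirchSwinnertonDyer.Theorems

namespace Summit.BirchSwinnertonDyer.BirchSwinnertonDyer.Theorems.AlignedTransportAtTwoTwistFamilyZhaiTransportMembers

/-! ## §1 `a_q(1727a1)` odd from «no root of `4x³ − 3x² − 304x + 1100` mod `q`» -/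

/-- The `b`-invariants of the integral model of `1727a1`: `b₂ = −3`, `b₄ = −152`, `b₆ = 1100`. [cite: CremonaAlgorithms1997, Table 1] -/
theorem integralModelInt_b_1727a1 : (integralModelInt c1727a1).b₂ = -3 ∧ (integralModelInt c1727a1).b₄ = -152 ∧
    (integralModelInt c1727a1).b₆ = 1100 := by
  have h : integralModelInt c1727a1 = M1727a1 := Instances.integralModelInt_baseChange_int M1727a1
  rw [h]
  exact ⟨by decide, by decide, by decide⟩

/-- **`a_q(1727a1)` odd from one `decide`**: for an odd prime `q ∤ 1727`, if `4x³ − 3x² − 304x + 1100` has no root in `ℤ/q` then `a_q(1727a1)`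
is odd (tree dictionary `TwoAdicTwistConverse.odd_frobeniusTrace_iff_forall_ne_zero`; good reduction at `q ∤ N = 1727`).
[cite: SilvermanAEC2009, III.2.3 and V.2] -/
theorem odd_frobeniusTrace_1727a1_of_forall_ne_zero {q : ℕ} [Fact q.Prime] (hq2 : q ≠ 2) (hqN : ¬ q ∣ 1727)
    (hno : ∀ x : ZMod q, 4 * x ^ 3 - 3 * x ^ 2 - 304 * x + 1100 ≠ 0) : Odd (c1727a1.frobeniusTrace q) := by
  have hgood : c1727a1.HasGoodReductionAtPrime q := by
    by_contra h
    exact hqN (by rw [← conductorNorm_1727a1]; exact (c1727a1.dvd_conductorNorm_iff_not_hasGoodReductionAtPrime q).mpr h)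
  rw [TwoAdicTwistConverse.odd_frobeniusTrace_iff_forall_ne_zero c1727a1 q hq2 hgood, integralModelInt_b_1727a1.1,
    integralModelInt_b_1727a1.2.1, integralModelInt_b_1727a1.2.2]
  intro x
  have h := hno x
  push_cast
  intro h'
  apply h
  linear_combination h'

/-! ## §1b No-root certificates mod `q` (one `decide` each) -/

/-- `4x³ − 3x² − 304x + 1100` has no root mod `3` (`a_{3}(1727a1)` odd). [cite: CremonaAlgorithms1997, Table 1] -/
theorem forall_ne_zero_1727a1_3 : ∀ x : ZMod 3, 4 * x ^ 3 - 3 * x ^ 2 - 304 * x + 1100 ≠ 0 := by decide +kernel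

/-- `4x³ − 3x² − 304x + 1100` has no root mod `29` (`a_{29}(1727a1)` odd). [cite: CremonaAlgorithms1997, Table 1] -/
theorem forall_ne_zero_1727a1_29 : ∀ x : ZMod 29, 4 * x ^ 3 - 3 * x ^ 2 - 304 * x + 1100 ≠ 0 := by decide +kernel

/-- `4x³ − 3x² − 304x + 1100` has no root mod `31` (`a_{31}(1727a1)` odd). [cite: CremonaAlgorithms1997, Table 1] -/
theorem forall_ne_zero_1727a1_31 : ∀ x : ZMod 31, 4 * x ^ 3 - 3 * x ^ 2 - 304 * x + 1100 ≠ 0 := by decide +kernel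

/-- `4x³ − 3x² − 304x + 1100` has no root mod `37` (`a_{37}(1727a1)` odd). [cite: CremonaAlgorithms1997, Table 1] -/
theorem forall_ne_zero_1727a1_37 : ∀ x : ZMod 37, 4 * x ^ 3 - 3 * x ^ 2 - 304 * x + 1100 ≠ 0 := by decide +kernel

/-- `4x³ − 3x² − 304x + 1100` has no root mod `41` (`a_{41}(1727a1)` odd). [cite: CremonaAlgorithms1997, Table 1] -/
theorem forall_ne_zero_1727a1_41 : ∀ x : ZMod 41, 4 * x ^ 3 - 3 * x ^ 2 - 304 * x + 1100 ≠ 0 := by decide +kernel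

/-- `4x³ − 3x² − 304x + 1100` has no root mod `43` (`a_{43}(1727a1)` odd). [cite: CremonaAlgorithms1997, Table 1] -/
theorem forall_ne_zero_1727a1_43 : ∀ x : ZMod 43, 4 * x ^ 3 - 3 * x ^ 2 - 304 * x + 1100 ≠ 0 := by decide +kernel

/-- `4x³ − 3x² − 304x + 1100` has no root mod `47` (`a_{47}(1727a1)` odd). [cite: CremonaAlgorithms1997, Table 1] -/
theorem forall_ne_zero_1727a1_47 : ∀ x : ZMod 47, 4 * x ^ 3 - 3 * x ^ 2 - 304 * x + 1100 ≠ 0 := by decide +kernel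

/-- `4x³ − 3x² − 304x + 1100` has no root mod `67` (`a_{67}(1727a1)` odd). [cite: CremonaAlgorithms1997, Table 1] -/
theorem forall_ne_zero_1727a1_67 : ∀ x : ZMod 67, 4 * x ^ 3 - 3 * x ^ 2 - 304 * x + 1100 ≠ 0 := by decide +kernel

/-- `4x³ − 3x² − 304x + 1100` has no root mod `71` (`a_{71}(1727a1)` odd). [cite: CremonaAlgorithms1997, Table 1] -/
theorem forall_ne_zero_1727a1_71 : ∀ x : ZMod 71, 4 * x ^ 3 - 3 * x ^ 2 - 304 * x + 1100 ≠ 0 := by decide +kernel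

/-- `4x³ − 3x² − 304x + 1100` has no root mod `73` (`a_{73}(1727a1)` odd). [cite: CremonaAlgorithms1997, Table 1] -/
theorem forall_ne_zero_1727a1_73 : ∀ x : ZMod 73, 4 * x ^ 3 - 3 * x ^ 2 - 304 * x + 1100 ≠ 0 := by decide +kernel

/-- `4x³ − 3x² − 304x + 1100` has no root mod `79` (`a_{79}(1727a1)` odd). [cite: CremonaAlgorithms1997, Table 1] -/
theorem forall_ne_zero_1727a1_79 : ∀ x : ZMod 79, 4 * x ^ 3 - 3 * x ^ 2 - 304 * x + 1100 ≠ 0 := by decide +kernel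

/-- `4x³ − 3x² − 304x + 1100` has no root mod `83` (`a_{83}(1727a1)` odd). [cite: CremonaAlgorithms1997, Table 1] -/
theorem forall_ne_zero_1727a1_83 : ∀ x : ZMod 83, 4 * x ^ 3 - 3 * x ^ 2 - 304 * x + 1100 ≠ 0 := by decide +kernel

/-- `4x³ − 3x² − 304x + 1100` has no root mod `107` (`a_{107}(1727a1)` odd). [cite: CremonaAlgorithms1997, Table 1] -/
theorem forall_ne_zero_1727a1_107 : ∀ x : ZMod 107, 4 * x ^ 3 - 3 * x ^ 2 - 304 * x + 1100 ≠ 0 := by decide +kernel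

/-! ## §2 Prime-star members of the `a_q`-odd class -/

section Members

variable (W : WeierstrassCurve ℚ) [W.IsElliptic] [W.IsGloballyMinimal]
  (h11 : thm11_ordTwo_LAlg_twist_eq_zero') (h12 : thm12_ordTwo_LAlg_twist_eq_one')
  (hMR' : MazurRubin2010.d2_eq_of_lemma210_rat) (hmod : exists_isNewformOf)
  (hAU : abbesUllmo_not_dvd_maninConstant_of_not_dvd_level)
  (hCM : bsdTriple_of_rank_le_one_of_conductor_lt) (hGZK : rank_eq_analyticRank_of_analyticRank_le_one)

include h11 h12 hMR' hmod hAU hCM hGZK in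
/-- **`BSD(W, 2)` by PRINT-TRANSPORT for every globally minimal model `W` of `1727a1^{(d)}`, `d = ±q` a prime-star** (`q` an odd prime, `q ∤ 1727`,
`d ∈ {q, −q}` with `d ≡ 1 (mod 4)`, and `4x³ − 3x² − 304x + 1100` without root mod `q` — i.e. `a_q(1727a1)` odd, one `decide`): `r_an(W) = 0 ∧ rank 0 ∧
Ш(W)[2^∞] = 0 ∧ c(W)` odd `∧ BSD(W, 2)`, modulo PRINT⁷ {Zhai 1.1′/1.2′, Mazur–Rubin L. 2.10, modularity, Abbes–Ullmo, Creutz–Miller, GZK} +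
displayed {`Dt`, `hL`} of `1727a1`. No Kato, no certificate. CONDITIONAL; BSD is NOT proved. [cite: Zhai2016, Thm. 1.1]
[cite: MazurRubin2010, Lemma 2.10] [cite: CreutzMiller2012, Thm. 1.1] [cite: AbbesUllmo1996, Thm. A] [cite: Miller2011LMS, Def. 1.1] -/
theorem bsdp_two_twist_1727a1_primeStar_of_forall_ne_zero [NeZero (c1727a1.conductorNorm ℤ)]
    (Dt : ModularParametrizationData c1727a1 (c1727a1.conductorNorm ℤ)) (hopt : Zhai2021.IsOptimalDatum c1727a1 Dt)
    (hL : ∃ x : ℚ, IsLAlg c1727a1 x ∧ x ≠ 0 ∧ padicValRat 2 x = 0)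
    {q : ℕ} [Fact q.Prime] (hq2 : q ≠ 2) (hqN : ¬ q ∣ 1727) (hno : ∀ x : ZMod q, 4 * x ^ 3 - 3 * x ^ 2 - 304 * x + 1100 ≠ 0)
    {d : ℤ} (hd : d = q ∨ d = -q) (hd4 : d % 4 = 1)
    {c : VariableChange ℚ} (hc : c • c1727a1.quadraticTwist (d : ℚ) = W) :
    W.analyticRank = 0 ∧ W.mordellWeilRank = 0 ∧ AddCommGroup.primaryComponent W.sha 2 = ⊥ ∧ Odd W.tamagawaProduct ∧ BSDp W 2 := by
  have hq : q.Prime := Fact.out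
  have hdabs : d.natAbs = q := by rcases hd with rfl | rfl <;> simp
  have hsqf : Squarefree d := by
    rw [← Int.squarefree_natAbs, hdabs]; exact hq.squarefree
  have hd1 : d ≠ 1 := by
    rintro rfl
    rw [Int.natAbs_one] at hdabs
    exact hq.one_lt.ne hdabs
  have hgcd : Int.gcd d 1727 = 1 := by
    rw [Int.gcd_eq_natAbs, hdabs]
    exact (Nat.Prime.coprime_iff_not_dvd hq).mpr hqN
  refine bsdp_two_twist_oddTrace_1727a1 W h11 h12 hMR' hmod hAU hCM hGZK Dt hopt hL hsqf hd1 hd4 hgcd (fun p hp hpd ↦ ?_) hc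
  have hpq : p = q := by
    have h1 : p ∣ d.natAbs := Int.natCast_dvd.mp hpd
    rw [hdabs] at h1
    exact (Nat.prime_dvd_prime_iff_eq hp hq).mp h1
  subst hpq
  exact odd_frobeniusTrace_1727a1_of_forall_ne_zero hq2 hqN hno

/-! ## §3 Members by `decide` -/

include h11 h12 hMR' hmod hAU hCM hGZK in
/-- **`BSD(W, 2)` by print-transport for every globally minimal model of `1727a1^{(−31)}`** (`N = 1 659 647`; no root mod `31`, `decide`). CONDITIONAL; BSD is NOT proved.
[cite: Zhai2016, Thm. 1.1] [cite: MazurRubin2010, Lemma 2.10] [cite: CreutzMiller2012, Thm. 1.1] [cite: Miller2011LMS, Def. 1.1] -/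
theorem bsdp_two_twist_1727a1_neg31 [NeZero (c1727a1.conductorNorm ℤ)]
    (Dt : ModularParametrizationData c1727a1 (c1727a1.conductorNorm ℤ)) (hopt : Zhai2021.IsOptimalDatum c1727a1 Dt)
    (hL : ∃ x : ℚ, IsLAlg c1727a1 x ∧ x ≠ 0 ∧ padicValRat 2 x = 0)
    {c : VariableChange ℚ} (hc : c • c1727a1.quadraticTwist ((-31 : ℤ) : ℚ) = W) : BSDp W 2 :=
  haveI : Fact (Nat.Prime 31) := ⟨by norm_num⟩
  (bsdp_two_twist_1727a1_primeStar_of_forall_ne_zero W h11 h12 hMR' hmod hAU hCM hGZK Dt hopt hL (q := 31) (by norm_num) (by norm_num)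
    forall_ne_zero_1727a1_31 (Or.inr (by norm_num)) (by decide) hc).2.2.2.2

include h11 h12 hMR' hmod hAU hCM hGZK in
/-- **`BSD(W, 2)` by print-transport for every globally minimal model of `1727a1^{(41)}`** (`N = 2 903 087`; no root mod `41`, `decide`). CONDITIONAL; BSD is NOT proved.
[cite: Zhai2016, Thm. 1.1] [cite: MazurRubin2010, Lemma 2.10] [cite: CreutzMiller2012, Thm. 1.1] [cite: Miller2011LMS, Def. 1.1] -/
theorem bsdp_two_twist_1727a1_41 [NeZero (c1727a1.conductorNorm ℤ)]
    (Dt : ModularParametrizationData c1727a1 (c1727a1.conductorNorm ℤ)) (hopt : Zhai2021.IsOptimalDatum c1727a1 Dt)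
    (hL : ∃ x : ℚ, IsLAlg c1727a1 x ∧ x ≠ 0 ∧ padicValRat 2 x = 0)
    {c : VariableChange ℚ} (hc : c • c1727a1.quadraticTwist ((41 : ℤ) : ℚ) = W) : BSDp W 2 :=
  haveI : Fact (Nat.Prime 41) := ⟨by norm_num⟩
  (bsdp_two_twist_1727a1_primeStar_of_forall_ne_zero W h11 h12 hMR' hmod hAU hCM hGZK Dt hopt hL (q := 41) (by norm_num) (by norm_num)
    forall_ne_zero_1727a1_41 (Or.inl (by norm_num)) (by decide) hc).2.2.2.2

include h11 h12 hMR' hmod hAU hCM hGZK in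
/-- **`BSD(W, 2)` by print-transport for every globally minimal model of `1727a1^{(-43)}`** (`N = 3 193 223`; no root mod `43`, `decide`). CONDITIONAL; BSD is NOT proved.
[cite: Zhai2016, Thm. 1.1] [cite: MazurRubin2010, Lemma 2.10] [cite: CreutzMiller2012, Thm. 1.1] [cite: Miller2011LMS, Def. 1.1] -/
theorem bsdp_two_twist_1727a1_neg43 [NeZero (c1727a1.conductorNorm ℤ)]
    (Dt : ModularParametrizationData c1727a1 (c1727a1.conductorNorm ℤ)) (hopt : Zhai2021.IsOptimalDatum c1727a1 Dt)
    (hL : ∃ x : ℚ, IsLAlg c1727a1 x ∧ x ≠ 0 ∧ padicValRat 2 x = 0)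
    {c : VariableChange ℚ} (hc : c • c1727a1.quadraticTwist ((-43 : ℤ) : ℚ) = W) : BSDp W 2 :=
  haveI : Fact (Nat.Prime 43) := ⟨by norm_num⟩
  (bsdp_two_twist_1727a1_primeStar_of_forall_ne_zero W h11 h12 hMR' hmod hAU hCM hGZK Dt hopt hL (q := 43) (by norm_num) (by norm_num)
    forall_ne_zero_1727a1_43 (Or.inr (by norm_num)) (by decide) hc).2.2.2.2

include h11 h12 hMR' hmod hAU hCM hGZK in
/-- **`BSD(W, 2)` by print-transport for every globally minimal model of `1727a1^{(-47)}`** (`N = 3 814 943`; no root mod `47`, `decide`). CONDITIONAL; BSD is NOT proved.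
[cite: Zhai2016, Thm. 1.1] [cite: MazurRubin2010, Lemma 2.10] [cite: CreutzMiller2012, Thm. 1.1] [cite: Miller2011LMS, Def. 1.1] -/
theorem bsdp_two_twist_1727a1_neg47 [NeZero (c1727a1.conductorNorm ℤ)]
    (Dt : ModularParametrizationData c1727a1 (c1727a1.conductorNorm ℤ)) (hopt : Zhai2021.IsOptimalDatum c1727a1 Dt)
    (hL : ∃ x : ℚ, IsLAlg c1727a1 x ∧ x ≠ 0 ∧ padicValRat 2 x = 0)
    {c : VariableChange ℚ} (hc : c • c1727a1.quadraticTwist ((-47 : ℤ) : ℚ) = W) : BSDp W 2 :=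
  haveI : Fact (Nat.Prime 47) := ⟨by norm_num⟩
  (bsdp_two_twist_1727a1_primeStar_of_forall_ne_zero W h11 h12 hMR' hmod hAU hCM hGZK Dt hopt hL (q := 47) (by norm_num) (by norm_num)
    forall_ne_zero_1727a1_47 (Or.inr (by norm_num)) (by decide) hc).2.2.2.2

include h11 h12 hMR' hmod hAU hCM hGZK in
/-- **`BSD(W, 2)` by print-transport for every globally minimal model of `1727a1^{(-67)}`** (`N = 7 752 503`; no root mod `67`, `decide`). CONDITIONAL; BSD is NOT proved.
[cite: Zhai2016, Thm. 1.1] [cite: MazurRubin2010, Lemma 2.10] [cite: CreutzMiller2012, Thm. 1.1] [cite: Miller2011LMS, Def. 1.1] -/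
theorem bsdp_two_twist_1727a1_neg67 [NeZero (c1727a1.conductorNorm ℤ)]
    (Dt : ModularParametrizationData c1727a1 (c1727a1.conductorNorm ℤ)) (hopt : Zhai2021.IsOptimalDatum c1727a1 Dt)
    (hL : ∃ x : ℚ, IsLAlg c1727a1 x ∧ x ≠ 0 ∧ padicValRat 2 x = 0)
    {c : VariableChange ℚ} (hc : c • c1727a1.quadraticTwist ((-67 : ℤ) : ℚ) = W) : BSDp W 2 :=
  haveI : Fact (Nat.Prime 67) := ⟨by norm_num⟩
  (bsdp_two_twist_1727a1_primeStar_of_forall_ne_zero W h11 h12 hMR' hmod hAU hCM hGZK Dt hopt hL (q := 67) (by norm_num) (by norm_num)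
    forall_ne_zero_1727a1_67 (Or.inr (by norm_num)) (by decide) hc).2.2.2.2

include h11 h12 hMR' hmod hAU hCM hGZK in
/-- **`BSD(W, 2)` by print-transport for every globally minimal model of `1727a1^{(-71)}`** (`N = 8 705 807`; no root mod `71`, `decide`). CONDITIONAL; BSD is NOT proved.
[cite: Zhai2016, Thm. 1.1] [cite: MazurRubin2010, Lemma 2.10] [cite: CreutzMiller2012, Thm. 1.1] [cite: Miller2011LMS, Def. 1.1] -/
theorem bsdp_two_twist_1727a1_neg71 [NeZero (c1727a1.conductorNorm ℤ)]
    (Dt : ModularParametrizationData c1727a1 (c1727a1.conductorNorm ℤ)) (hopt : Zhai2021.IsOptimalDatum c1727a1 Dt)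
    (hL : ∃ x : ℚ, IsLAlg c1727a1 x ∧ x ≠ 0 ∧ padicValRat 2 x = 0)
    {c : VariableChange ℚ} (hc : c • c1727a1.quadraticTwist ((-71 : ℤ) : ℚ) = W) : BSDp W 2 :=
  haveI : Fact (Nat.Prime 71) := ⟨by norm_num⟩
  (bsdp_two_twist_1727a1_primeStar_of_forall_ne_zero W h11 h12 hMR' hmod hAU hCM hGZK Dt hopt hL (q := 71) (by norm_num) (by norm_num)
    forall_ne_zero_1727a1_71 (Or.inr (by norm_num)) (by decide) hc).2.2.2.2

include h11 h12 hMR' hmod hAU hCM hGZK in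
/-- **`BSD(W, 2)` by print-transport for every globally minimal model of `1727a1^{(73)}`** (`N = 9 203 183`; no root mod `73`, `decide`). CONDITIONAL; BSD is NOT proved.
[cite: Zhai2016, Thm. 1.1] [cite: MazurRubin2010, Lemma 2.10] [cite: CreutzMiller2012, Thm. 1.1] [cite: Miller2011LMS, Def. 1.1] -/
theorem bsdp_two_twist_1727a1_73 [NeZero (c1727a1.conductorNorm ℤ)]
    (Dt : ModularParametrizationData c1727a1 (c1727a1.conductorNorm ℤ)) (hopt : Zhai2021.IsOptimalDatum c1727a1 Dt)
    (hL : ∃ x : ℚ, IsLAlg c1727a1 x ∧ x ≠ 0 ∧ padicValRat 2 x = 0)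
    {c : VariableChange ℚ} (hc : c • c1727a1.quadraticTwist ((73 : ℤ) : ℚ) = W) : BSDp W 2 :=
  haveI : Fact (Nat.Prime 73) := ⟨by norm_num⟩
  (bsdp_two_twist_1727a1_primeStar_of_forall_ne_zero W h11 h12 hMR' hmod hAU hCM hGZK Dt hopt hL (q := 73) (by norm_num) (by norm_num)
    forall_ne_zero_1727a1_73 (Or.inl (by norm_num)) (by decide) hc).2.2.2.2

include h11 h12 hMR' hmod hAU hCM hGZK in
/-- **`BSD(W, 2)` by print-transport for every globally minimal model of `1727a1^{(-79)}`** (`N = 10 778 207`; no root mod `79`, `decide`). CONDITIONAL; BSD is NOT proved.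
[cite: Zhai2016, Thm. 1.1] [cite: MazurRubin2010, Lemma 2.10] [cite: CreutzMiller2012, Thm. 1.1] [cite: Miller2011LMS, Def. 1.1] -/
theorem bsdp_two_twist_1727a1_neg79 [NeZero (c1727a1.conductorNorm ℤ)]
    (Dt : ModularParametrizationData c1727a1 (c1727a1.conductorNorm ℤ)) (hopt : Zhai2021.IsOptimalDatum c1727a1 Dt)
    (hL : ∃ x : ℚ, IsLAlg c1727a1 x ∧ x ≠ 0 ∧ padicValRat 2 x = 0)
    {c : VariableChange ℚ} (hc : c • c1727a1.quadraticTwist ((-79 : ℤ) : ℚ) = W) : BSDp W 2 :=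
  haveI : Fact (Nat.Prime 79) := ⟨by norm_num⟩
  (bsdp_two_twist_1727a1_primeStar_of_forall_ne_zero W h11 h12 hMR' hmod hAU hCM hGZK Dt hopt hL (q := 79) (by norm_num) (by norm_num)
    forall_ne_zero_1727a1_79 (Or.inr (by norm_num)) (by decide) hc).2.2.2.2

include h11 h12 hMR' hmod hAU hCM hGZK in
/-- **`BSD(W, 2)` by print-transport for every globally minimal model of `1727a1^{(-83)}`** (`N = 11 897 303`; no root mod `83`, `decide`). CONDITIONAL; BSD is NOT proved.
[cite: Zhai2016, Thm. 1.1] [cite: MazurRubin2010, Lemma 2.10] [cite: CreutzMiller2012, Thm. 1.1] [cite: Miller2011LMS, Def. 1.1] -/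
theorem bsdp_two_twist_1727a1_neg83 [NeZero (c1727a1.conductorNorm ℤ)]
    (Dt : ModularParametrizationData c1727a1 (c1727a1.conductorNorm ℤ)) (hopt : Zhai2021.IsOptimalDatum c1727a1 Dt)
    (hL : ∃ x : ℚ, IsLAlg c1727a1 x ∧ x ≠ 0 ∧ padicValRat 2 x = 0)
    {c : VariableChange ℚ} (hc : c • c1727a1.quadraticTwist ((-83 : ℤ) : ℚ) = W) : BSDp W 2 :=
  haveI : Fact (Nat.Prime 83) := ⟨by norm_num⟩
  (bsdp_two_twist_1727a1_primeStar_of_forall_ne_zero W h11 h12 hMR' hmod hAU hCM hGZK Dt hopt hL (q := 83) (by norm_num) (by norm_num)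
    forall_ne_zero_1727a1_83 (Or.inr (by norm_num)) (by decide) hc).2.2.2.2

include h11 h12 hMR' hmod hAU hCM hGZK in
/-- **`BSD(W, 2)` by print-transport for every globally minimal model of `1727a1^{(-107)}`** (`N = 19 772 423`; no root mod `107`, `decide`). CONDITIONAL; BSD is NOT proved.
[cite: Zhai2016, Thm. 1.1] [cite: MazurRubin2010, Lemma 2.10] [cite: CreutzMiller2012, Thm. 1.1] [cite: Miller2011LMS, Def. 1.1] -/
theorem bsdp_two_twist_1727a1_neg107 [NeZero (c1727a1.conductorNorm ℤ)]
    (Dt : ModularParametrizationData c1727a1 (c1727a1.conductorNorm ℤ)) (hopt : Zhai2021.IsOptimalDatum c1727a1 Dt)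
    (hL : ∃ x : ℚ, IsLAlg c1727a1 x ∧ x ≠ 0 ∧ padicValRat 2 x = 0)
    {c : VariableChange ℚ} (hc : c • c1727a1.quadraticTwist ((-107 : ℤ) : ℚ) = W) : BSDp W 2 :=
  haveI : Fact (Nat.Prime 107) := ⟨by norm_num⟩
  (bsdp_two_twist_1727a1_primeStar_of_forall_ne_zero W h11 h12 hMR' hmod hAU hCM hGZK Dt hopt hL (q := 107) (by norm_num) (by norm_num)
    forall_ne_zero_1727a1_107 (Or.inr (by norm_num)) (by decide) hc).2.2.2.2

include h11 h12 hMR' hmod hAU hCM hGZK in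
/-- **`BSD(W, 2)` by print-transport for every globally minimal model of `1727a1^{(37)}`** (`N = 2 364 263`; no root mod `37`, `decide`) (`37` is also in Zhai's arXiv-v2 split family — g23 `bsdp_two_twist_1727a1_37`, BSD₂ IN PRINT there). CONDITIONAL; BSD is NOT proved.
[cite: Zhai2016, Thm. 1.1] [cite: MazurRubin2010, Lemma 2.10] [cite: CreutzMiller2012, Thm. 1.1] [cite: Miller2011LMS, Def. 1.1] -/
theorem bsdp_two_twist_1727a1_37 [NeZero (c1727a1.conductorNorm ℤ)]
    (Dt : ModularParametrizationData c1727a1 (c1727a1.conductorNorm ℤ)) (hopt : Zhai2021.IsOptimalDatum c1727a1 Dt)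
    (hL : ∃ x : ℚ, IsLAlg c1727a1 x ∧ x ≠ 0 ∧ padicValRat 2 x = 0)
    {c : VariableChange ℚ} (hc : c • c1727a1.quadraticTwist ((37 : ℤ) : ℚ) = W) : BSDp W 2 :=
  haveI : Fact (Nat.Prime 37) := ⟨by norm_num⟩
  (bsdp_two_twist_1727a1_primeStar_of_forall_ne_zero W h11 h12 hMR' hmod hAU hCM hGZK Dt hopt hL (q := 37) (by norm_num) (by norm_num)
    forall_ne_zero_1727a1_37 (Or.inl (by norm_num)) (by decide) hc).2.2.2.2

include h11 h12 hMR' hmod hAU hCM hGZK in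
/-- **`BSD(W, 2)` by print-transport for every globally minimal model of `1727a1^{(−87)}`** (`−87 = (−3)·29`, `N = 13 071 663`; no root mod `3` and mod `29`).
CONDITIONAL; BSD is NOT proved. [cite: Zhai2016, Thm. 1.1] [cite: MazurRubin2010, Lemma 2.10] [cite: CreutzMiller2012, Thm. 1.1] [cite: Miller2011LMS, Def. 1.1] -/
theorem bsdp_two_twist_1727a1_neg87 [NeZero (c1727a1.conductorNorm ℤ)]
    (Dt : ModularParametrizationData c1727a1 (c1727a1.conductorNorm ℤ)) (hopt : Zhai2021.IsOptimalDatum c1727a1 Dt)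
    (hL : ∃ x : ℚ, IsLAlg c1727a1 x ∧ x ≠ 0 ∧ padicValRat 2 x = 0)
    {c : VariableChange ℚ} (hc : c • c1727a1.quadraticTwist ((-87 : ℤ) : ℚ) = W) : BSDp W 2 := by
  have hsq : Squarefree (-87 : ℤ) := by
    rw [← Int.squarefree_natAbs, show (-87 : ℤ).natAbs = 3 * 29 from rfl]
    exact (Nat.squarefree_mul ((Nat.coprime_primes Nat.prime_three (by norm_num)).mpr (by norm_num))).mpr
      ⟨Nat.prime_three.squarefree, (by norm_num : Nat.Prime 29).squarefree⟩
  refine (bsdp_two_twist_oddTrace_1727a1 W h11 h12 hMR' hmod hAU hCM hGZK Dt hopt hL hsq (by decide) (by decide) (by decide)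
    (fun q hq hqd ↦ ?_) hc).2.2.2.2
  haveI : Fact q.Prime := ⟨hq⟩
  have h1 : q ∣ 3 * 29 := by
    have h := Int.natCast_dvd.mp hqd
    rwa [show (-87 : ℤ).natAbs = 3 * 29 from rfl] at h
  rcases (Nat.Prime.dvd_mul hq).mp h1 with h | h
  · have h3 : q = 3 := (Nat.prime_dvd_prime_iff_eq hq Nat.prime_three).mp h
    subst h3
    exact odd_frobeniusTrace_1727a1_of_forall_ne_zero (by norm_num) (by norm_num) forall_ne_zero_1727a1_3
  · have h29 : q = 29 := (Nat.prime_dvd_prime_iff_eq hq (by norm_num)).mp h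
    subst h29
    exact odd_frobeniusTrace_1727a1_of_forall_ne_zero (by norm_num) (by norm_num) forall_ne_zero_1727a1_29

include h11 h12 hMR' hmod hAU hCM hGZK in
/-- **`BSD(W, 2)` by print-transport for every globally minimal model of `1727a1^{(93)}`** (`93 = 3·31`, `N = 14 936 423`; no root mod `3` and mod `31`;
`93` is also in Zhai's arXiv-v2 split family — g23 `bsdp_two_twist_1727a1_93`, BSD₂ IN PRINT there). CONDITIONAL; BSD is NOT proved.
[cite: Zhai2016, Thm. 1.1] [cite: MazurRubin2010, Lemma 2.10] [cite: CreutzMiller2012, Thm. 1.1] [cite: Miller2011LMS, Def. 1.1] -/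
theorem bsdp_two_twist_1727a1_93' [NeZero (c1727a1.conductorNorm ℤ)]
    (Dt : ModularParametrizationData c1727a1 (c1727a1.conductorNorm ℤ)) (hopt : Zhai2021.IsOptimalDatum c1727a1 Dt)
    (hL : ∃ x : ℚ, IsLAlg c1727a1 x ∧ x ≠ 0 ∧ padicValRat 2 x = 0)
    {c : VariableChange ℚ} (hc : c • c1727a1.quadraticTwist ((93 : ℤ) : ℚ) = W) : BSDp W 2 := by
  have hsq : Squarefree (93 : ℤ) := by
    rw [show (93 : ℤ) = ((3 * 31 : ℕ) : ℤ) by norm_num]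
    exact Int.squarefree_natCast.mpr
      ((Nat.squarefree_mul ((Nat.coprime_primes Nat.prime_three (by norm_num)).mpr (by norm_num))).mpr
        ⟨Nat.prime_three.squarefree, (by norm_num : Nat.Prime 31).squarefree⟩)
  refine (bsdp_two_twist_oddTrace_1727a1 W h11 h12 hMR' hmod hAU hCM hGZK Dt hopt hL hsq (by decide) (by decide) (by decide)
    (fun q hq hqd ↦ ?_) hc).2.2.2.2
  haveI : Fact q.Prime := ⟨hq⟩
  have h1 : q ∣ 3 * 31 := by
    have h := Int.natCast_dvd.mp hqd
    rwa [show (93 : ℤ).natAbs = 3 * 31 from rfl] at h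
  rcases (Nat.Prime.dvd_mul hq).mp h1 with h | h
  · have h3 : q = 3 := (Nat.prime_dvd_prime_iff_eq hq Nat.prime_three).mp h
    subst h3
    exact odd_frobeniusTrace_1727a1_of_forall_ne_zero (by norm_num) (by norm_num) forall_ne_zero_1727a1_3
  · have h31 : q = 31 := (Nat.prime_dvd_prime_iff_eq hq (by norm_num)).mp h
    subst h31
    exact odd_frobeniusTrace_1727a1_of_forall_ne_zero (by norm_num) (by norm_num) forall_ne_zero_1727a1_31

end Members

end Summit.BirchSwinnertonDyer.BirchSwinnertonDyer.Theorems.AlignedTransportAtTwoTwistFamilyZhaiTransportMembers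

end
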